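import Mathlib
import Summits.Ventures.PercRepro.TriangleCapFiveRowFourPieces
import Summits.Ventures.PercRepro.TriangleCapBroom

/-!
# PercRepro — THE ROW `a = 5` AT `r = 4`: a `K₄⁻`-free graph with `5 (k − 5) − 4` edges on `k ≥ 14` vertices is
`5`-bipartite or at least `4` below the closed form — hence THE SECOND-BEST VALUE OF THE CHERRY TABLE ON THE CELL
`(k, 5, 4)` IS `closed − 4`, the brooms (p3, gen 46; part 199x)

The induction on `k` of part 199r one row up: the cap is part 199v; every degree in `[6, k − 6]` gives `k (k − 11) ≥ 4`
by the convexity of the row `6`; a vertex `z` of degree `d ≤ 5` is deleted onto `(k − 1, 5, d − 1)` (`d ≥ 1`; parts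
195–199i) or `(k − 1, 6, k − 13)` (`d = 0`); `d = 5` is the induction hypothesis for `k ≥ 15` and, AT THE CORNER
`k = 14`, the diagonal `(13, 36)` of the row `a = 4` at third order (part 199u: `K_{4,9}` makes `D` `5`-bipartite;
`5`-bipartite `D − z` is the side lemma; the rest is `≤ 434` with `T ≤ 35`, `434 + 70 + 30 = 534 = m k − 40`
exactly). `five_four_second_best (14 ≤ k)`: the second-best value of `Σ_v d(v)²` over the non-extremal `K₄⁻`-free
graphs on `Fin k` with `5 (k − 5) − 4` edges is EXACTLY `m k − 4 (k − 5) − 4` (`broom_value`). Axioms: standard.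
-/

namespace PercRepro

namespace TriangleCap

namespace C047

open Finset

universe u

variable {V : Type*} [Fintype V] [DecidableEq V]

/-- **THE ROW `a = 5` AT `r = 3`, EVERY VERTEX TYPE, BY INDUCTION ON `k`:** `K₄⁻`-free, `m + 3 = 5 (k − 5)`,
`13 ≤ k` ⇒ `5`-bipartite or `Σ_v d(v)² + 3 (k − 4) + (2k − 22) ≤ m k`. -/
theorem five_four_second_order_aux (n : ℕ) :
    ∀ (W : Type u) [Fintype W] [DecidableEq W] (D : SimpleGraph W) [DecidableRel D.Adj], Fintype.card W = n →
      K4mFree D → 14 ≤ Fintype.card W → D.edgeFinset.card + 4 = 5 * (Fintype.card W - 5) →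
      (∃ A : Finset W, A.card = 5 ∧ BipSub D A) ∨
        ∑ v, deg D v * deg D v + 4 * (Fintype.card W - 5) + 4 ≤ D.edgeFinset.card * Fintype.card W := by
  refine Nat.strong_induction_on n ?_
  intro n ih W _ _ D _ hn hK hk hm
  -- (A) a vertex at the cap `k − 5`
  by_cases hx : ∃ x, deg D x + 5 = Fintype.card W
  · obtain ⟨x, hx⟩ := hx
    exact five_four_cap D hK hk hm x hx
  push Not at hx
  have hcap : ∀ v, deg D v + 5 ≤ Fintype.card W := fun v =>
    deg_add_le_card_of_dense D hK 5 (by norm_num) (by omega)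
      (cap_arith 5 (Fintype.card W) D.edgeFinset.card 4 (by norm_num) (by omega) (by omega)) v
  have hcap' : ∀ v, deg D v + 5 + 1 ≤ Fintype.card W := fun v => by
    have h1 := hcap v
    have h2 := hx v
    omega
  have hcap7 : ∀ v, deg D v ≤ (Fintype.card W - 7) + 1 := fun v => by have := hcap' v; omega
  -- (B) every degree `≥ 6`: the convexity of the row `6`
  by_cases hdeg : ∀ v, 5 + 1 ≤ deg D v
  · right
    have h := below_convex_gen D 5 4 (by norm_num) (by omega) hm hcap' hdeg
    have h2 : 2 * (Fintype.card W - 2 * 5 - 1) ≤ Fintype.card W * (Fintype.card W - 2 * 5 - 1) :=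
      Nat.mul_le_mul_right _ (by omega)
    omega
  push Not at hdeg
  obtain ⟨z, hz⟩ := hdeg
  -- the deletion bookkeeping
  have hK' := k4mFree_del D hK z
  have hcard' := card_del z
  have hedges' := card_edges_del D z
  have hsq := sum_deg_sq_del D z
  have hT := sum_del_nbhd_le D z (Fintype.card W - 7) hcap7
  have hNz := card_nbhd_del D z
  obtain ⟨T, hTdef⟩ : ∃ T, ∑ a : {v : W // v ≠ z}, (if D.Adj a.1 z then deg (del D z) a else 0) = T := ⟨_, rfl⟩
  obtain ⟨S', hS'def⟩ : ∃ S', ∑ a : {v : W // v ≠ z}, deg (del D z) a * deg (del D z) a = S' := ⟨_, rfl⟩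
  obtain ⟨m', hm'def⟩ : ∃ m', (del D z).edgeFinset.card = m' := ⟨_, rfl⟩
  obtain ⟨Nz, hNzdef⟩ : ∃ Nz : Finset {v : W // v ≠ z},
      Nz = univ.filter (fun a : {v : W // v ≠ z} => D.Adj a.1 z) := ⟨_, rfl⟩
  have hmemNz : ∀ a : {v : W // v ≠ z}, a ∈ Nz ↔ D.Adj a.1 z := fun a => by
    rw [hNzdef, mem_filter]
    simp only [mem_univ, true_and]
  rw [← hNzdef] at hNz
  rw [hTdef, hS'def] at hsq
  rw [hTdef] at hT
  rw [hm'def] at hedges'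
  obtain ⟨s, hs⟩ : ∃ s, Fintype.card W = s + 14 := ⟨Fintype.card W - 14, by omega⟩
  have hcardW' : Fintype.card {v : W // v ≠ z} = s + 13 := by omega
  -- the side lemma for a `5`-bipartite `D − z`
  have hside : ∀ A' : Finset {v : W // v ≠ z}, A'.card = 5 → BipSub (del D z) A' →
      (∃ A : Finset W, A.card = 5 ∧ BipSub D A) ∨
        (∑ v, deg D v * deg D v + 4 * (Fintype.card W - 5) + 4 ≤ D.edgeFinset.card * Fintype.card W) ∨
        (T + (Fintype.card W - 7) ≤ deg D z * (Fintype.card W - 7) + 5) := by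
    intro A' hA'card hB
    have := five_four_sides D hk hm z A' hA'card hB hcap7
    rw [hTdef] at this
    exact this
  have hd : deg D z = 0 ∨ deg D z = 1 ∨ deg D z = 2 ∨ deg D z = 3 ∨ deg D z = 4 ∨ deg D z = 5 := by omega
  rcases hd with hd0 | hd1 | hd2 | hd3 | hd4 | hd5
  · -- `d = 0`: the closed form on `(k − 1, 6, k − 13)`
    right
    have hm'0 : m' = 5 * s + 41 := by omega
    have h := closed_form_stability (del D z) hK' 6 (s + 14 - 13) (by norm_num) (by rw [hcardW']; omega)
      (by rw [hm'def, hcardW', hm'0]; omega)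
    rw [hS'def, hm'def, hcardW'] at h
    have e : s + 13 - 1 - (s + 14 - 13) = 11 := by omega
    rw [e] at h
    rw [hd0, hs] at hT
    rw [hsq, ← hedges', hs, hd0]
    exact five_four_del_zero_arith s m' S' T hm'0 h hT
  · -- `d = 1`: the diagonal `(k − 1, 5, 0)` at second order
    have hm'1 : m' = 5 * s + 40 := by omega
    rcases diag_second_order_gen (del D z) hK' 5 (by norm_num) (by omega) (by rw [hm'def, hcardW', hm'1]; omega)
      with ⟨A', hA'card, hB⟩ | hgap
    · rcases hside A' hA'card hB with h | h | hT'
      · exact Or.inl h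
      · exact Or.inr h
      · -- a single neighbour cannot be mixed; the envelope closes
        right
        have henv := sum_deg_sq_le_of_k4mFree (del D z) hK' (by omega)
        rw [hS'def, hm'def, hcardW'] at henv
        rw [hs, hd1] at hT'
        rw [hsq, ← hedges', hs, hd1]
        have e2 : s + 14 - 5 = s + 9 := by omega
        have e4 : s + 14 - 7 = s + 7 := by omega
        rw [e4] at hT'
        rw [e2]
        subst hm'1
        nlinarith [henv, hT']
    · right
      rw [hS'def, hm'def, hcardW'] at hgap
      rw [hd1, hs] at hT
      rw [hsq, ← hedges', hs, hd1]
      exact five_four_del_one_gap_arith s m' S' T hm'1 hgap hT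
  · -- `d = 2`: the cell `(k − 1, 5, 1)`
    have hm'2 : m' = 5 * s + 39 := by omega
    rcases one_below_second_order_gen (del D z) hK' 5 (by norm_num) (by omega)
      (by rw [hm'def, hcardW', hm'2]; omega) with ⟨A', hA'card, hB⟩ | hgap
    · rcases hside A' hA'card hB with h | h | hT'
      · exact Or.inl h
      · exact Or.inr h
      · right
        have hS := sum_deg_sq_le_of_bipSub (del D z) A' hB 5 1 hA'card (by rw [hm'def, hcardW', hm'2]; omega)
          (by omega)
        rw [hS'def, hm'def, hcardW'] at hS
        rw [hs, hd2] at hT'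
        rw [hsq, ← hedges', hs, hd2]
        exact five_four_del_two_mixed_arith s m' S' T hm'2 hS hT'
    · right
      rw [hS'def, hm'def, hcardW'] at hgap
      rw [hd2, hs] at hT
      rw [hsq, ← hedges', hs, hd2]
      exact five_four_del_two_gap_arith s m' S' T hm'2 hgap hT
  · -- `d = 3`: the cell `(k − 1, 5, 2)`
    have hm'3 : m' = 5 * s + 38 := by omega
    rcases below_second_order_gen (del D z) hK' 5 2 (by norm_num) (by norm_num) (by norm_num) (by omega)
      (by rw [hm'def, hcardW', hm'3]; omega) with ⟨A', hA'card, hB⟩ | hgap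
    · rcases hside A' hA'card hB with h | h | hT'
      · exact Or.inl h
      · exact Or.inr h
      · right
        have hS := sum_deg_sq_le_of_bipSub (del D z) A' hB 5 2 hA'card (by rw [hm'def, hcardW', hm'3]; omega)
          (by omega)
        rw [hS'def, hm'def, hcardW'] at hS
        rw [hs, hd3] at hT'
        rw [hsq, ← hedges', hs, hd3]
        exact five_four_del_three_mixed_arith s m' S' T hm'3 hS hT'
    · right
      rw [hS'def, hm'def, hcardW'] at hgap
      rw [hd3, hs] at hT
      rw [hsq, ← hedges', hs, hd3]
      exact five_four_del_three_gap_arith s m' S' T hm'3 hgap hT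
  · -- `d = 4`: the cell `(k − 1, 5, 3)`
    have hm'4 : m' = 5 * s + 37 := by omega
    rcases five_three_second_order (del D z) hK' (by omega) (by rw [hm'def, hcardW', hm'4]; omega)
      with ⟨A', hA'card, hB⟩ | hgap
    · rcases hside A' hA'card hB with h | h | hT'
      · exact Or.inl h
      · exact Or.inr h
      · right
        have hS := sum_deg_sq_le_of_bipSub (del D z) A' hB 5 3 hA'card (by rw [hm'def, hcardW', hm'4]; omega)
          (by omega)
        rw [hS'def, hm'def, hcardW'] at hS
        rw [hs, hd4] at hT'
        rw [hsq, ← hedges', hs, hd4]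
        exact five_four_del_four_mixed_arith s m' S' T hm'4 hS hT'
    · right
      rw [hS'def, hm'def, hcardW'] at hgap
      rw [hd4, hs] at hT
      rw [hsq, ← hedges', hs, hd4]
      exact five_four_del_four_gap_arith s m' S' T hm'4 hgap hT
  · -- `d = 5`: the cell `(k − 1, 5, 4)`
    have hm'5 : m' = 5 * s + 36 := by omega
    rcases Nat.eq_zero_or_pos s with hs0 | hspos
    · -- the corner `k = 14`: `D − z` on `(13, 36)` at third order
      subst hs0
      have hk13 : Fintype.card W = 14 := by omega
      have hcard12 : Fintype.card {v : W // v ≠ z} = 13 := by omega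
      have hm'32 : m' = 36 := by omega
      rcases four_diag_third_order_thirteen (del D z) hK' hcard12 (by rw [hm'def, hm'32])
        with ⟨A', hA'card, hA'⟩ | ⟨A', hA'card, hB⟩ | hthird
      · -- `D − z = K_{4,9}`: the five neighbours of `z` lie off the `4`-side
        have hfull : ∀ {x y : {v : W // v ≠ z}}, x ∈ A' → y ∉ A' → (del D z).Adj x y := fun hx hy =>
          adj_of_bipSub_full (del D z) A' hA' 4 hA'card (by rw [hm'def, hcard12, hm'32]) hx hy
        have hall : ¬ ∀ a : {v : W // v ≠ z}, D.Adj a.1 z → a ∈ A' := by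
          intro hall
          have hsub : Nz ⊆ A' := fun a ha => hall a ((hmemNz a).mp ha)
          have := card_le_card hsub
          omega
        push Not at hall
        obtain ⟨a₀, ha₀z, ha₀A⟩ := hall
        have hoff : ∀ a : {v : W // v ≠ z}, D.Adj a.1 z → a ∉ A' := by
          intro a₁ ha₁z ha₁A
          have hne01 : a₀ ≠ a₁ := fun h => ha₀A (h ▸ ha₁A)
          obtain ⟨a₂, ha₂z, ha₂0, ha₂1⟩ : ∃ a₂ : {v : W // v ≠ z}, D.Adj a₂.1 z ∧ a₂ ≠ a₀ ∧ a₂ ≠ a₁ := by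
            have h2 : 2 < Nz.card := by omega
            obtain ⟨b₁, hb₁, b₂, hb₂, b₃, hb₃, h12, h13, h23⟩ := two_lt_card.mp h2
            rw [hmemNz] at hb₁ hb₂ hb₃
            by_cases e1 : b₁ = a₀ ∨ b₁ = a₁
            · by_cases e2 : b₂ = a₀ ∨ b₂ = a₁
              · refine ⟨b₃, hb₃, ?_, ?_⟩
                · intro h; rcases e1 with rfl | rfl <;> rcases e2 with rfl | rfl <;>
                    first | exact h12 rfl | exact h13 h | exact h13 h.symm | exact h23 h | exact h23 h.symm
                · intro h; rcases e1 with rfl | rfl <;> rcases e2 with rfl | rfl <;>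
                    first | exact h12 rfl | exact h13 h | exact h13 h.symm | exact h23 h | exact h23 h.symm
              · push Not at e2
                exact ⟨b₂, hb₂, e2.1, e2.2⟩
            · push Not at e1
              exact ⟨b₁, hb₁, e1.1, e1.2⟩
          have h10 : D.Adj a₁.1 a₀.1 := (del_adj D z a₁ a₀).mp (hfull ha₁A ha₀A)
          by_cases ha₂A : a₂ ∈ A'
          · have h20 : D.Adj a₂.1 a₀.1 := (del_adj D z a₂ a₀).mp (hfull ha₂A ha₀A)
            exact not_adj_both D hK (D.adj_symm ha₀z) (D.adj_symm ha₁z) (D.adj_symm h10)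
              (fun h => ha₂1 (Subtype.ext h).symm) (D.adj_symm ha₂z) (D.adj_symm h20)
          · have h12' : D.Adj a₁.1 a₂.1 := (del_adj D z a₁ a₂).mp (hfull ha₁A ha₂A)
            exact not_adj_both D hK (D.adj_symm ha₁z) (D.adj_symm ha₀z) h10
              (fun h => ha₂0 (Subtype.ext h).symm) (D.adj_symm ha₂z) h12'
        obtain ⟨B, hBcard, hB⟩ := bipSub_insert_of_nbhd_off D z A' hA' hoff
        exact Or.inl ⟨B, by rw [hBcard, hA'card], hB⟩
      · -- `D − z` is `5`-bipartite on `(13, 5, 4)`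
        rcases hside A' hA'card hB with h | h | hT'
        · exact Or.inl h
        · exact Or.inr h
        · right
          have hS := sum_deg_sq_le_of_bipSub (del D z) A' hB 5 4 hA'card (by rw [hm'def, hcard12, hm'32])
            (by omega)
          rw [hS'def, hm'def, hcard12, hm'32] at hS
          rw [hk13, hd5] at hT'
          rw [hsq, ← hedges', hk13, hd5, hm'32]
          omega
      · -- `D − z` neither `4`- nor `5`-bipartite: at most `434`
        right
        rw [hS'def, hm'def, hcard12, hm'32] at hthird
        rw [hd5, hk13] at hT
        rw [hsq, ← hedges', hk13, hd5, hm'32]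
        omega
    · -- `k ≥ 14`: the induction hypothesis on `(k − 1, 5, 3)`
      rcases ih (Fintype.card {v : W // v ≠ z}) (by omega) {v : W // v ≠ z} (del D z) rfl hK' (by omega)
        (by rw [hm'def, hcardW', hm'5]; omega) with ⟨A', hA'card, hB⟩ | hgap
      · rcases hside A' hA'card hB with h | h | hT'
        · exact Or.inl h
        · exact Or.inr h
        · right
          have hS := sum_deg_sq_le_of_bipSub (del D z) A' hB 5 4 hA'card (by rw [hm'def, hcardW', hm'5]; omega)
            (by omega)
          rw [hS'def, hm'def, hcardW'] at hS
          rw [hs, hd5] at hT'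
          rw [hsq, ← hedges', hs, hd5]
          exact five_four_del_five_mixed_arith s m' S' T hm'5 hS hT'
      · right
        rw [hS'def, hm'def, hcardW'] at hgap
        rw [hd5, hs] at hT
        rw [hsq, ← hedges', hs, hd5]
        exact five_four_del_five_gap_arith s m' S' T hm'5 hgap hT

/-- **THE ROW `a = 5` AT `r = 4`:** `K₄⁻`-free, `m + 4 = 5 (k − 5)`, `14 ≤ k` ⇒ `D` is a spanning subgraph of some
`K(A, Aᶜ)` with `|A| = 5`, or `Σ_v d(v)² + 4 (k − 5) + 4 ≤ m k`. -/
theorem five_four_second_order (D : SimpleGraph V) [DecidableRel D.Adj] (hK : K4mFree D)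
    (hk : 14 ≤ Fintype.card V) (hm : D.edgeFinset.card + 4 = 5 * (Fintype.card V - 5)) :
    (∃ A : Finset V, A.card = 5 ∧ BipSub D A) ∨
      ∑ v, deg D v * deg D v + 4 * (Fintype.card V - 5) + 4 ≤ D.edgeFinset.card * Fintype.card V :=
  five_four_second_order_aux (Fintype.card V) V D rfl hK hk hm

/-- **THE SECOND-BEST VALUE ON `(k, 5, 4)`, `k ≥ 14`:** every non-extremal `K₄⁻`-free graph on `Fin k` with
`5 (k − 5) − 4` edges has `Σ_v d(v)² + 4 (k − 5) + 4 ≤ m k`, and the value is attained (`K_{5,k−5}` minus a broom). -/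
theorem five_four_second_best (k : ℕ) (hk : 14 ≤ k) :
    (∀ (D : SimpleGraph (Fin k)) [DecidableRel D.Adj], K4mFree D → D.edgeFinset.card + 4 = 5 * (k - 5) →
        ∑ v, deg D v * deg D v + 4 * (k - 5) ≠ D.edgeFinset.card * k →
        ∑ v, deg D v * deg D v + 4 * (k - 5) + 4 ≤ D.edgeFinset.card * k) ∧
      ∃ (D : SimpleGraph (Fin k)) (_ : DecidableRel D.Adj), K4mFree D ∧ D.edgeFinset.card + 4 = 5 * (k - 5) ∧
        ∑ v, deg D v * deg D v + 4 * (k - 5) + 4 = D.edgeFinset.card * k := by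
  have hcard : Fintype.card (Fin k) = k := Fintype.card_fin k
  refine ⟨?_, ?_⟩
  · intro D _ hK hm hne
    rcases five_four_second_order D hK (by omega) (by rw [hcard]; exact hm) with ⟨A, hAcard, hB⟩ | h
    · by_cases hstar : ∃ v, MissingStar D A v
      · obtain ⟨v, hv⟩ := hstar
        have h := closed_form_eq_of_missingStar D A hB hv 5 4 hAcard (by rw [hcard]; omega) (by omega)
        rw [hcard] at h
        have e : k - 1 - 4 = k - 5 := by omega
        rw [e] at h
        exact absurd h hne
      · have h := closed_form_stability_bipSub D A hB 5 4 hAcard (by rw [hcard]; omega) (by omega) (by norm_num)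
          hstar
        rw [hcard] at h
        have e : k - 1 - 4 = k - 5 := by omega
        rw [e] at h
        omega
    · rw [hcard] at h
      exact h
  · obtain ⟨D, inst, A, hK, hAcard, hB, hns, hE, hS⟩ := broom_value k 5 4 (by norm_num) (by norm_num) (by omega)
    have hE' : D.edgeFinset.card + 4 = 5 * (k - 5) := by
      rw [hE]
      have : 4 ≤ 5 * (k - 5) := by omega
      omega
    refine ⟨D, inst, hK, hE', ?_⟩
    have e : k - 1 - 4 = k - 5 := by omega
    rw [e] at hS
    rw [hE]
    have e2 : 2 * (4 - 2) = 4 := by norm_num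
    rw [e2] at hS
    exact hS

end C047

end TriangleCap

end PercRepro
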